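import Summits.PneNP.PneNP.Theorems.PeaWorstToAvg.Negative.PeaWorstToAvgAdviceAsymmetry
import Literature.Computability.MetaComplexity.SamplableMixtures
import Literature.Computability.Complexity.PolyTimeCountable
import Literature.Computability.Complexity.RandomizedProofs

/-!
# PneNP / SzkEntropy — crux `PeaWorstToAvg` (stmt-PneNP-10777), negative side: the hypotheses of the
# advice-elimination stub are LOAD-BEARING (`UHeurBPP ⊊ HeurBPP` already on point-mass ensembles)

Standing-disprover content (`Cruxes/PeaWorstToAvg/Disproof.lean` §8, line `dual-mode-compile`, stub
`stub_adviceElim`: a tree `HeurBPP` scheme — coin budget `coinLen` an arbitrary polynomially bounded, hence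
advice-carrying, function of the input length, cf. `PeaWorstToAvgAdviceAsymmetry.lean` — for a LABELLED
mixture of two uniformly SAMPLABLE certified components is to be replaced by a UNIFORM scheme, coin budget an
honest polynomial).  Both hypothesis classes are necessary, unconditionally:
* `countable_uniformSchemes` — uniform schemes form a countable set of `RandAlg`s
  (`countable_setOf_polyTimeComputable`; `ℕ[X]` countable);
* `not_forall_sizeClass_uniform`, `exists_sizeClass_heurBPP_not_uniform` — every size-class language
  `{x | a (size |x|)}` is `HeurBPP`-easy on every ensemble (`mem_HeurBPP_sizeClass`), but on `n ↦ δ_{1ⁿ}` a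
  uniform scheme determines `a` (`schemeKey_eq`: the atom `1ⁿ`, `n = 2^{t-1}`, cannot be bad at `m = 2`),
  and `ℕ → Bool` is uncountable: `UHeurBPP ⊊ HeurBPP` on a samplable (coin-free) ensemble;
* `adviceElim_false_without_labels` — the stub WITHOUT its certification hypotheses `h₀`/`h₁` (all else
  verbatim, `∈ UHeurBPP` unfolded) is FALSE: `Q_a = ({x | a(size|x|)}, {x | ¬a(size|x|)})`, both samplers
  the unary identity `1ⁿ ↦ 1ⁿ`;
* `adviceElim_false_without_samplability` — the stub WITHOUT samplability of the components (labels KEPT: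
  arbitrary ensembles `K₀ ⊆ Q.no`, `K₁ ⊆ Q.yes`) is FALSE: interleave `a(3t)=1, a(3t+1)=0, a(3t+2)=c t` and
  put the `c`-dependent atom of size class `3t+2` on its correct side at parameter `t`; a uniform scheme
  at `(t, m = 4)` must answer `c t` on it.  So a proof of the stub must draw its OWN LABELLED test samples.

References: A. Bogdanov, L. Trevisan, *Average-Case Complexity*, FnT–TCS 2 (2006), Def. 2.12–2.13, §2.3;
S. Arora, B. Barak, *Computational Complexity* (2009), §1.4, Def. 7.1–7.3, §6.3; R. Karp, R. Lipton,
*Turing machines that take advice*, Enseign. Math. 28 (1982).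
-/

namespace Summit.PneNP.PneNP.Theorems

open Literature.Computability.Complexity Literature.Computability.MetaComplexity
open _root_.Computability
open scoped ENNReal

/-! ### Small facts -/

/-- `size (2ᵗ / 2) = t`. [folklore] -/
theorem size_two_pow_div_two (t : ℕ) : (2 ^ t / 2).size = t := by
  rcases Nat.eq_zero_or_pos t with rfl | ht
  · simp [Nat.size_zero]
  · have : 2 ^ t / 2 = 2 ^ (t - 1) := by
      rw [show t = (t - 1) + 1 from by omega, pow_succ]
      simp
    rw [this, Nat.size_pow]
    omega

/-- The two atoms of a law on `Bool` sum to one (real form). [folklore] -/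
theorem toReal_apply_true_eq (p : PMF Bool) : (p true).toReal = 1 - (p false).toReal := by
  have h : p false + p true = 1 := by
    have := p.tsum_coe
    rwa [tsum_bool] at this
  have h' : (p false).toReal + (p true).toReal = 1 := by
    rw [← ENNReal.toReal_add (PMF.apply_ne_top p false) (PMF.apply_ne_top p true), h, ENNReal.toReal_one]
  linarith

/-- Cantor: `ℕ → Bool` is uncountable. [folklore] -/
theorem false_of_countable_natBool (h : Countable (ℕ → Bool)) : False := by
  obtain ⟨e, he⟩ := exists_surjective_nat (ℕ → Bool)
  obtain ⟨k, hk⟩ := he fun n => !(e n n)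
  have h := congrFun hk k
  cases h' : e k k <;> simp [h'] at h

/-- The error event "output `≠ c`" of a Boolean algorithm is the atom `!c`. [folklore] -/
theorem pr_ne_eq_toReal_apply_not (A : RandAlg (List Bool × ℕ × ℕ) Bool) (q : List Bool × ℕ × ℕ)
    (c : Bool) : A.pr schemeEnc q {b | b ≠ c} = ((A.outputPMF schemeEnc q) (!c)).toReal := by
  have hset : ({b | b ≠ c} : Set Bool) = {!c} := by
    ext b
    cases b <;> cases c <;> simp
  rw [RandAlg.pr, hset, PMF.toOuterMeasure_apply_singleton]

/-- The fair mixture of an ensemble with itself is the ensemble. [folklore] -/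
theorem mixEnsemble_self (K : Ensemble) : mixEnsemble K K = K := by
  funext n
  ext y
  rw [mixEnsemble_apply, ← add_mul, ENNReal.inv_two_add_inv_two, one_mul]

/-! ### Uniform schemes are countable -/

/-- **Uniform schemes form a countable set**: a `RandAlg` is the pair (run map, coin budget); the run
maps of `IsPolyTime` schemes are polynomial-time computable functions — countably many, by the reduction
of Mathlib's `FinTM2` machines to standard machines (`countable_setOf_polyTimeComputable`) — and honest
coin budgets are values of `ℕ[X]`, countable. [AroraBarakCC2009, §1.4; Gill1977, §5] -/
theorem countable_uniformSchemes :
    Set.Countable {A : RandAlg (List Bool × ℕ × ℕ) Bool | A.IsPolyTime schemeEnc encodeBool ∧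
      ∃ c : Polynomial ℕ, ∀ ℓ, A.coinLen ℓ = c.eval ℓ} := by
  have h1 : Set.Countable {f : (List Bool × ℕ × ℕ) × List Bool → Bool |
      PolyTimeComputable (fun p : (List Bool × ℕ × ℕ) × List Bool => boolPair (schemeEnc p.1) p.2)
        encodeBool f} :=
    countable_setOf_polyTimeComputable _ (Function.LeftInverse.injective decode_encodeBool)
  have h2 : Set.Countable {g : ℕ → ℕ | ∃ c : Polynomial ℕ, ∀ ℓ, g ℓ = c.eval ℓ} := by
    haveI : Countable (Polynomial ℕ) :=
      (AddMonoidAlgebra.coeff_injective.comp Polynomial.toFinsupp_injective).countable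
    have hsub : {g : ℕ → ℕ | ∃ c : Polynomial ℕ, ∀ ℓ, g ℓ = c.eval ℓ} ⊆
        Set.range (fun c : Polynomial ℕ => fun ℓ => c.eval ℓ) := by
      rintro g ⟨c, hc⟩
      exact ⟨c, (funext hc).symm⟩
    exact (Set.countable_range _).mono hsub
  refine Set.MapsTo.countable_of_injOn
    (f := fun A : RandAlg (List Bool × ℕ × ℕ) Bool => (Function.uncurry A.run, A.coinLen))
    ?_ ?_ (h1.prod h2)
  · intro A hA
    exact Set.mk_mem_prod hA.1.1 hA.2
  · intro A _ A' _ h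
    obtain ⟨r, c⟩ := A
    obtain ⟨r', c'⟩ := A'
    simp only [Prod.mk.injEq, RandAlg.mk.injEq] at h ⊢
    exact ⟨funext fun q => funext fun s => congrFun h.1 (q, s), h.2⟩

/-- No injection of `ℕ → Bool` into the uniform schemes (countable vs. Cantor). [folklore] -/
theorem false_of_injective_uniformSchemes (A : (ℕ → Bool) → RandAlg (List Bool × ℕ × ℕ) Bool)
    (hinj : Function.Injective A) (hA : ∀ a, (A a).IsPolyTime schemeEnc encodeBool ∧
      ∃ c : Polynomial ℕ, ∀ ℓ, (A a).coinLen ℓ = c.eval ℓ) : False := by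
  have hc : (Set.range A).Countable := countable_uniformSchemes.mono (by rintro _ ⟨a, rfl⟩; exact hA a)
  haveI : Countable (Set.range A) := hc.to_subtype
  exact false_of_countable_natBool (Function.Injective.countable
    (f := fun a : ℕ → Bool => (⟨A a, a, rfl⟩ : Set.range A)) fun a b h => hinj (congrArg Subtype.val h))

/-! ### A uniform scheme on `δ_{1ⁿ}` determines the size-class language it serves -/

/-- **A scheme for `({x | a (size |x|)}, δ_{1ⁿ})` carries the key `a`**: bit `t` of the key read off a
scheme is "the scheme says `true` with probability `> 1/2` on the atom `1ⁿ`, `n = 2ᵗ/2` (size class `t`),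
at failure parameter `m = 2`"; at that parameter the ensemble IS the atom (mass `1 > 1/2`), so the atom
is not in the bad set: the scheme errs on it with probability `< 1/4`, and its majority answer is
`[1ⁿ ∈ L] = a (size n) = a t`. [BogdanovTrevisan2006, Def. 2.12–2.13] -/
theorem schemeKey_eq (a : ℕ → Bool) (A : RandAlg (List Bool × ℕ × ℕ) Bool)
    (hA : ∀ n m : ℕ, 0 < m →
      Ensemble.prob (fun n => PMF.pure (unaryEncodeNat n)) n
        {x | 1 / 4 ≤ A.pr schemeEnc (x, n, m)
          {b | b ≠ ({x : List Bool | a x.length.size = true} : Set (List Bool)).boolIndicator x}} ≤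
        1 / m) (t : ℕ) :
    decide ((1 : ℝ) / 2 <
      ((A.outputPMF schemeEnc (unaryEncodeNat (2 ^ t / 2), 2 ^ t / 2, 2)) true).toReal) = a t := by
  set n : ℕ := 2 ^ t / 2 with hn
  have hsize : n.size = t := by
    rw [hn]
    exact size_two_pow_div_two t
  have hmemiff : unaryEncodeNat n ∈ ({x : List Bool | a x.length.size = true} : Set (List Bool)) ↔
      a t = true := by
    rw [Set.mem_setOf_eq, show (unaryEncodeNat n).length = n from unary_decode_encode_nat n, hsize]
  have hind : ({x : List Bool | a x.length.size = true} : Set (List Bool)).boolIndicator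
      (unaryEncodeNat n) = a t := by
    cases h : a t
    · exact (Set.notMem_iff_boolIndicator _ _).1 (by rw [hmemiff, h]; exact Bool.false_ne_true)
    · exact (Set.mem_iff_boolIndicator _ _).1 (by rw [hmemiff, h])
  -- the atom is not bad at `m = 2`
  have hgood : A.pr schemeEnc (unaryEncodeNat n, n, 2)
      {b | b ≠ ({x : List Bool | a x.length.size = true} : Set (List Bool)).boolIndicator
        (unaryEncodeNat n)} < 1 / 4 := by
    by_contra hbad
    push Not at hbad
    have h2 := hA n 2 (by norm_num)
    have hmem : unaryEncodeNat n ∈ {x | 1 / 4 ≤ A.pr schemeEnc (x, n, 2)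
        {b | b ≠ ({x : List Bool | a x.length.size = true} : Set (List Bool)).boolIndicator x}} := hbad
    rw [Ensemble.prob, PMF.toOuterMeasure_pure_apply, if_pos hmem, ENNReal.toReal_one] at h2
    norm_num at h2
  rw [hind, pr_ne_eq_toReal_apply_not] at hgood
  cases h : a t
  · rw [h] at hgood
    simp only [Bool.not_false] at hgood
    rw [decide_eq_false_iff_not, not_lt]
    linarith
  · rw [h] at hgood
    simp only [Bool.not_true] at hgood
    rw [decide_eq_true_iff, toReal_apply_true_eq]
    linarith

/-! ### The separation and the refuted unlabelled advice elimination -/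

/-- **Not every size-class language has a UNIFORM scheme on `δ_{1ⁿ}`.** If every `a : ℕ → Bool` had a
uniform scheme `A_a` (polynomial-time, honest polynomial coin budget) for `({x | a (size |x|)}, δ_{1ⁿ})`,
then `a =` (key of `A_a`, `schemeKey_eq`) would inject `ℕ → Bool` into the countable set of uniform schemes — but
`ℕ → Bool` is uncountable (Cantor's diagonal). [AroraBarakCC2009, §1.4 and §6.3; KarpLipton1982] -/
theorem not_forall_sizeClass_uniform :
    ¬ ∀ a : ℕ → Bool, ∃ A : RandAlg (List Bool × ℕ × ℕ) Bool, A.IsPolyTime schemeEnc encodeBool ∧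
      (∃ c : Polynomial ℕ, ∀ ℓ, A.coinLen ℓ = c.eval ℓ) ∧
      ∀ n m : ℕ, 0 < m →
        Ensemble.prob (fun n => PMF.pure (unaryEncodeNat n)) n
          {x | 1 / 4 ≤ A.pr schemeEnc (x, n, m)
            {b | b ≠ ({x : List Bool | a x.length.size = true} : Set (List Bool)).boolIndicator x}} ≤
          1 / m := by
  intro H
  choose A hA using H
  have hkey : ∀ a t, decide ((1 : ℝ) / 2 <
      (((A a).outputPMF schemeEnc (unaryEncodeNat (2 ^ t / 2), 2 ^ t / 2, 2)) true).toReal) = a t :=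
    fun a t => schemeKey_eq a (A a) (hA a).2.2 t
  have hinj : Function.Injective A := fun a b hab => by
    funext t
    rw [← hkey a t, ← hkey b t, hab]
  exact false_of_injective_uniformSchemes A hinj fun a => ⟨(hA a).1, (hA a).2.1⟩

/-- **`UHeurBPP ⊊ HeurBPP` on a samplable ensemble (tree model).** Some size-class language is
`HeurBPP`-easy on `δ_{1ⁿ}` (indeed every one is, on every ensemble: `mem_HeurBPP_sizeClass` — the scheme
reads bit `size |x|` of its own coin COUNT) but has NO uniform scheme there. [BogdanovTrevisan2006,
Def. 2.12–2.13; AroraBarakCC2009, §6.3; KarpLipton1982] -/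
theorem exists_sizeClass_heurBPP_not_uniform :
    ∃ a : ℕ → Bool,
      (⟨{x | a x.length.size = true}, fun n => PMF.pure (unaryEncodeNat n)⟩ : DistProblem) ∈ HeurBPP ∧
      ¬ ∃ A : RandAlg (List Bool × ℕ × ℕ) Bool, A.IsPolyTime schemeEnc encodeBool ∧
        (∃ c : Polynomial ℕ, ∀ ℓ, A.coinLen ℓ = c.eval ℓ) ∧
        ∀ n m : ℕ, 0 < m →
          Ensemble.prob (fun n => PMF.pure (unaryEncodeNat n)) n
            {x | 1 / 4 ≤ A.pr schemeEnc (x, n, m)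
              {b | b ≠ ({x : List Bool | a x.length.size = true} : Set (List Bool)).boolIndicator x}} ≤
            1 / m := by
  by_contra h
  push Not at h
  exact not_forall_sizeClass_uniform fun a => h a (mem_HeurBPP_sizeClass a _)

/-- The coin-free UNARY IDENTITY sampler `1ⁿ ↦ 1ⁿ` is a uniform polynomial-time sampler (coin budget the
zero polynomial) with law `δ_{1ⁿ}`. [BogdanovTrevisan2006, Def. 2.1] -/
theorem unarySampler_props :
    (RandAlg.ofDet fun n : ℕ => unaryEncodeNat n).IsPolyTime unaryEncodeNat (id : List Bool → List Bool) ∧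
      (∀ ℓ, (RandAlg.ofDet fun n : ℕ => unaryEncodeNat n).coinLen ℓ = (0 : Polynomial ℕ).eval ℓ) ∧
      ∀ n, (RandAlg.ofDet fun n : ℕ => unaryEncodeNat n).outputPMF unaryEncodeNat n =
        PMF.pure (unaryEncodeNat n) := by
  refine ⟨RandAlg.IsPolyTime.ofDet_holds ?_, fun ℓ => by simp [RandAlg.ofDet], fun n =>
    RandAlg.outputPMF_ofDet _ _ _⟩
  exact PolyTimeComputable.of_encode_eq (f := fun w : List Bool => w) unaryEncodeNat
    (fun _ => rfl) (fun _ => rfl) (PolyTimeComputable.id _)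

/-- **Advice elimination is FALSE without the labels.**  The negated statement is `stub_adviceElim` of
line `dual-mode-compile` (skeleton fd0625e15dd7) WITHOUT its two certification hypotheses
(`h₀ : supp S false ⊆ Q.no`, `h₁ : supp S true ⊆ Q.yes`), everything else verbatim (disjoint `Q`, uniform
samplers with a common polynomial coin budget, the fair mixture, `HeurBPP`-membership; the conclusion
`∈ UHeurBPP` unfolded: a scheme with an honest polynomial coin budget).  Refutation: instantiate at
`Q_a = ({x | a (size |x|)}, {x | ¬ a (size |x|)})` (disjoint) and both samplers the unary identity; the
mixture is `δ_{1ⁿ}`, `HeurBPP`-easy for every `a` (`mem_HeurBPP_sizeClass`), so the statement would give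
every size-class language a uniform scheme on `δ_{1ⁿ}` — refuted by `not_forall_sizeClass_uniform`.  The
certification hypotheses of `stub_adviceElim` are load-bearing. [BogdanovTrevisan2006, §2.3;
AroraBarakCC2009, §6.3; KarpLipton1982] -/
theorem adviceElim_false_without_labels :
    ¬ ∀ (Q : PromiseProblem), Q.Disjoint → ∀ (S : Bool → RandAlg ℕ (List Bool)),
      (∀ b, (S b).IsPolyTime unaryEncodeNat (id : List Bool → List Bool)) →
      ∀ c : Polynomial ℕ, (∀ b ℓ, (S b).coinLen ℓ = c.eval ℓ) →
      (⟨Q.yes, mixEnsemble (fun n => (S false).outputPMF unaryEncodeNat n)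
          (fun n => (S true).outputPMF unaryEncodeNat n)⟩ : DistProblem) ∈ HeurBPP →
      ∃ A : RandAlg (List Bool × ℕ × ℕ) Bool, A.IsPolyTime schemeEnc encodeBool ∧
        (∃ c : Polynomial ℕ, ∀ ℓ, A.coinLen ℓ = c.eval ℓ) ∧
        ∀ n m : ℕ, 0 < m →
          (mixEnsemble (fun n => (S false).outputPMF unaryEncodeNat n)
            (fun n => (S true).outputPMF unaryEncodeNat n)).prob n
            {x | 1 / 4 ≤ A.pr schemeEnc (x, n, m) {b | b ≠ Q.yes.boolIndicator x}} ≤ 1 / m := by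
  intro H
  obtain ⟨hS, hc, hlaw⟩ := unarySampler_props
  refine not_forall_sizeClass_uniform fun a => ?_
  have hQ : (⟨{x | a x.length.size = true}, {x | a x.length.size = false}⟩ : PromiseProblem).Disjoint := by
    refine Set.disjoint_left.2 fun x h1 h2 => ?_
    simp only [Set.mem_setOf_eq] at h1 h2
    rw [h1] at h2
    exact Bool.noConfusion h2
  have hmix : mixEnsemble (fun n => (RandAlg.ofDet fun n : ℕ => unaryEncodeNat n).outputPMF unaryEncodeNat n)
      (fun n => (RandAlg.ofDet fun n : ℕ => unaryEncodeNat n).outputPMF unaryEncodeNat n) =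
      fun n => PMF.pure (unaryEncodeNat n) := by
    rw [mixEnsemble_self]
    funext n
    exact hlaw n
  have h := H ⟨{x | a x.length.size = true}, {x | a x.length.size = false}⟩ hQ
    (fun _ => RandAlg.ofDet fun n : ℕ => unaryEncodeNat n) (fun _ => hS) 0 (fun _ => hc)
    (by rw [hmix]; exact mem_HeurBPP_sizeClass a _)
  rw [hmix] at h
  exact h


/-! ### Advice elimination also fails without SAMPLABILITY of the certified components -/

/-- The interleaved advice function: `true` on `3t`, `false` on `3t+1`, `c t` on `3t+2`. [folklore] -/
theorem interleave_spec (c : ℕ → Bool) :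
    ∃ a : ℕ → Bool, (∀ t, a (3 * t) = true) ∧ (∀ t, a (3 * t + 1) = false) ∧ ∀ t, a (3 * t + 2) = c t := by
  refine ⟨fun s => if s % 3 = 0 then true else if s % 3 = 1 then false else c (s / 3), ?_, ?_, ?_⟩
  · intro t; simp
  · intro t; simp [Nat.add_mod]
  · intro t
    have h1 : (3 * t + 2) % 3 = 2 := by omega
    have h2 : (3 * t + 2) / 3 = t := by omega
    simp [h1, h2]

/-- **`stub_adviceElim` WITHOUT samplability of the components is FALSE** (labels kept!).  The negated
statement: for every disjoint `Q` and every pair of ENSEMBLES `K₀ ⊆ Q.no`, `K₁ ⊆ Q.yes` (certified, but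
not assumed samplable), `HeurBPP`-membership of `(Q.yes, ½K₀+½K₁)` gives a uniform scheme.  Refutation:
for `c : ℕ → Bool` let `a` interleave (`a(3t) = 1`, `a(3t+1) = 0`, `a(3t+2) = c t`), `Q = ({x | a(size|x|)},
{x | ¬a(size|x|)})`, and at parameter `t` put the two atoms on the strings `w(3t+2)` and `w(3t)` / `w(3t+1)`
(`|w(s)|` of size `s`) so that the `c`-dependent atom `w(3t+2)` sits on its correct side; the mixture is
`HeurBPP`-easy (`mem_HeurBPP_sizeClass`), and a uniform scheme at `(t, m = 4)` must answer `c t` on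
`w(3t+2)` — so `c` would be determined by a member of the countable set of uniform schemes, for every `c`.
Hence BOTH the certificates AND the samplers are load-bearing in `stub_adviceElim`: the proof must draw its
own labelled test samples. [BogdanovTrevisan2006, §2.3, Def. 2.12–2.13; AroraBarakCC2009, §6.3;
KarpLipton1982] -/
theorem adviceElim_false_without_samplability :
    ¬ ∀ (Q : PromiseProblem), Q.Disjoint → ∀ (K₀ K₁ : Ensemble),
      (∀ n, ∀ w ∈ (K₀ n).support, w ∈ Q.no) → (∀ n, ∀ w ∈ (K₁ n).support, w ∈ Q.yes) →
      (⟨Q.yes, mixEnsemble K₀ K₁⟩ : DistProblem) ∈ HeurBPP →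
      ∃ A : RandAlg (List Bool × ℕ × ℕ) Bool, A.IsPolyTime schemeEnc encodeBool ∧
        (∃ c : Polynomial ℕ, ∀ ℓ, A.coinLen ℓ = c.eval ℓ) ∧
        ∀ n m : ℕ, 0 < m →
          (mixEnsemble K₀ K₁).prob n
            {x | 1 / 4 ≤ A.pr schemeEnc (x, n, m) {b | b ≠ Q.yes.boolIndicator x}} ≤ 1 / m := by
  intro H
  -- strings of prescribed size class
  let w : ℕ → List Bool := fun s => unaryEncodeNat (2 ^ s / 2)
  have hw : ∀ s, (w s).length.size = s := fun s => by
    show (unaryEncodeNat (2 ^ s / 2)).length.size = s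
    rw [show (unaryEncodeNat (2 ^ s / 2)).length = 2 ^ s / 2 from unary_decode_encode_nat _]
    exact size_two_pow_div_two s
  -- for every `c`, a uniform scheme whose key is `c`
  have key : ∀ c : ℕ → Bool, ∃ A : RandAlg (List Bool × ℕ × ℕ) Bool,
      (A.IsPolyTime schemeEnc encodeBool ∧ ∃ c : Polynomial ℕ, ∀ ℓ, A.coinLen ℓ = c.eval ℓ) ∧
      ∀ t, decide ((1 : ℝ) / 2 < ((A.outputPMF schemeEnc (w (3 * t + 2), t, 4)) true).toReal) = c t := by
    intro c
    obtain ⟨a, ha0, ha1, ha2⟩ := interleave_spec c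
    let L : Set (List Bool) := {x | a x.length.size = true}
    have hmemL : ∀ s, w s ∈ L ↔ a s = true := fun s => by
      show a (w s).length.size = true ↔ a s = true
      rw [hw]
    -- the two certified point-mass ensembles
    let K₁ : Ensemble := fun t => PMF.pure (if c t then w (3 * t + 2) else w (3 * t))
    let K₀ : Ensemble := fun t => PMF.pure (if c t then w (3 * t + 1) else w (3 * t + 2))
    have hK₁ : ∀ n, ∀ x ∈ (K₁ n).support, x ∈ L := by
      intro n x hx
      have hx' : x = (if c n then w (3 * n + 2) else w (3 * n)) := by simpa [K₁] using hx
      rw [hx']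
      cases hc : c n
      · simpa [hmemL] using ha0 n
      · simp only [if_true]
        rw [hmemL, ha2, hc]
    have hK₀ : ∀ n, ∀ x ∈ (K₀ n).support, x ∈ Lᶜ := by
      intro n x hx
      have hx' : x = (if c n then w (3 * n + 1) else w (3 * n + 2)) := by simpa [K₀] using hx
      rw [hx', Set.mem_compl_iff]
      cases hc : c n
      · simp only [Bool.false_eq_true, if_false]
        rw [hmemL, ha2, hc]
        exact Bool.false_ne_true
      · simp only [if_true]
        rw [hmemL, ha1]
        exact Bool.false_ne_true
    have hQ : (⟨L, Lᶜ⟩ : PromiseProblem).Disjoint := disjoint_compl_right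
    obtain ⟨A, hA, hc, hbad⟩ := H ⟨L, Lᶜ⟩ hQ K₀ K₁ hK₀ hK₁ (mem_HeurBPP_sizeClass a _)
    refine ⟨A, ⟨hA, hc⟩, fun t => ?_⟩
    -- the `c`-dependent atom `w (3t+2)` is an atom of the mixture, hence not bad at `m = 4`
    have hatom : (2 : ℝ≥0∞)⁻¹ ≤ (mixEnsemble K₀ K₁ t).toOuterMeasure {w (3 * t + 2)} := by
      rw [toOuterMeasure_mixEnsemble]
      cases hc : c t
      · have : (K₀ t).toOuterMeasure {w (3 * t + 2)} = 1 := by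
          simp [K₀, hc]
        rw [this, mul_one]
        exact le_self_add
      · have : (K₁ t).toOuterMeasure {w (3 * t + 2)} = 1 := by
          simp [K₁, hc]
        rw [this, mul_one]
        exact le_add_self
    have hgood : A.pr schemeEnc (w (3 * t + 2), t, 4) {b | b ≠ L.boolIndicator (w (3 * t + 2))} < 1 / 4 := by
      by_contra hb
      push Not at hb
      have h4 := hbad t 4 (by norm_num)
      have hsub : {w (3 * t + 2)} ⊆ {x | 1 / 4 ≤ A.pr schemeEnc (x, t, 4) {b | b ≠ L.boolIndicator x}} := by
        rintro _ rfl
        exact hb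
      have hle : (2 : ℝ≥0∞)⁻¹ ≤ (mixEnsemble K₀ K₁ t).toOuterMeasure
          {x | 1 / 4 ≤ A.pr schemeEnc (x, t, 4) {b | b ≠ L.boolIndicator x}} :=
        hatom.trans (PMF.toOuterMeasure_mono _ fun x hx => hsub hx.1)
      have hreal : (1 : ℝ) / 2 ≤ (mixEnsemble K₀ K₁).prob t
          {x | 1 / 4 ≤ A.pr schemeEnc (x, t, 4) {b | b ≠ L.boolIndicator x}} := by
        rw [Ensemble.prob]
        have := ENNReal.toReal_mono (ne_top_of_le_ne_top ENNReal.one_ne_top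
          (PMF.toOuterMeasure_mono _ (Set.subset_univ _) |>.trans_eq
            ((PMF.toOuterMeasure_apply_eq_one_iff _ _).2 (Set.subset_univ _)))) hle
        simpa using this
      norm_num at h4
      linarith
    -- read the key off
    have hind : L.boolIndicator (w (3 * t + 2)) = c t := by
      cases h : c t
      · exact (Set.notMem_iff_boolIndicator _ _).1 (by rw [hmemL, ha2, h]; exact Bool.false_ne_true)
      · exact (Set.mem_iff_boolIndicator _ _).1 (by rw [hmemL, ha2, h])
    rw [hind, pr_ne_eq_toReal_apply_not] at hgood
    cases h : c t
    · rw [h] at hgood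
      simp only [Bool.not_false] at hgood
      rw [decide_eq_false_iff_not, not_lt]
      linarith
    · rw [h] at hgood
      simp only [Bool.not_true] at hgood
      rw [decide_eq_true_iff, toReal_apply_true_eq]
      linarith
  -- countability contradiction
  choose A hA using key
  have hinj : Function.Injective A := fun c c' h => by
    funext t
    rw [← (hA c).2 t, ← (hA c').2 t, h]
  exact false_of_injective_uniformSchemes A hinj fun c => (hA c).1

end Summit.PneNP.PneNP.Theorems
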